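import Summits.CriticalPhenomena.PercolationContinuityZ3.Theorems.PercNearOneGluingNoHeavyQuantSliceClosure
import Summits.CriticalPhenomena.PercolationContinuityZ3.Theorems.PercNearOneGluingNoHeavyQuantLawDecAbsorb
import HarnessLib

/-!
# QUANT lane R8, T-DEC: slice bookkeeping and the SMALL-LAYER case of Conjecture SL (layers `j′ < a`: criterion E, no
# DEC hypothesis at all)

builds on p205010 (kernel theorem, internal audit signed; external expert review pending)

Support file (`--supports stmt-CriticalPhenomena-4575`), QUANT lane typer seat prim-quant-stmt (gen 22), rung R8 of
`run/shared/lean/prim/quant/LADDER.md`.  Theorems only, standard axioms, no sorries.  Continues prim-quant-census-2 g53's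
`…QuantSliceClosure` (`LawDec.slice`, the `@[conjecture]` `LawDec.SliceClosed`) and g52's `…QuantLawDecAbsorb` (criterion E
`LawDec.decAt_of_giantsAbsorbLows`).

WHAT IS HERE.  (1) The law facts of a one-blob slice `LawDec.slice μ a g` (`h ↦ (1−g)·μ h + g·μ(h−a)·[a ≤ h]`) of an ARBITRARY law
`μ` on `{0..M}`: nonnegativity, vanishing above `M + a`, mass `1`, mean `T + a·g` — the bookkeeping every argument about SL needs
(g53 proved them for blob lists only, `sum_blobLaw` / `sum_mul_blobLaw`).  (2) **`LawDec.slice_decAt_of_lt`: for layers `j′ < a` the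
slice is DEC(j′) at every floor `0 < x ≤ g` with NO hypothesis on `μ`** (memo DEC-CLOSURE-G53 §0 (1) / §3.2: "for `a > j′` the slice is
criterion E outright", census 566/0): every atom of the shifted row `h ≥ a ≥ j′+1` is a giant, so the giant mass is `≥ g ≥ x`, the low
mass is `≤ 1 − (giant mass)`, and `x·P(low) ≤ x·(1 − P_G) ≤ (1 − x)·P_G`; criterion E (`decAt_of_giantsAbsorbLows`) decomposes.  So the
content of `LawDec.SliceClosed` is the range `a ≤ j′ < M + a` only; `LawDec.sliceClosed_iff_le` records that equivalence.

[this work]; DEC rules ARCH-TREES-G49 §2.2 / DEC-TAMP-G50 §3.1, memo DEC-CLOSURE-G53 (this lane).  The gluing rows served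
[cite: KozmaNitzan2024, Conjecture 3 (p. 15)]; product measure [cite: Grimmett1999, §1.3 p. 10].
-/

noncomputable section

namespace Summit.CriticalPhenomena.PercolationContinuityZ3.Theorems

namespace Quant

open Finset

namespace LawDec

/-! ### Law facts of a slice -/

/-- a slice of a nonnegative law by a gate `g ∈ [0,1]` is nonnegative. [this work] -/
theorem slice_nonneg (μ : ℕ → ℝ) (a : ℕ) (g : ℝ) (hg0 : 0 ≤ g) (hg1 : g ≤ 1) (hμ0 : ∀ h, 0 ≤ μ h) (h : ℕ) :
    0 ≤ slice μ a g h := by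
  simp only [slice]
  refine add_nonneg (mul_nonneg (by linarith) (hμ0 h)) (mul_nonneg hg0 ?_)
  split_ifs
  · exact hμ0 _
  · exact le_rfl

/-- a slice of a law vanishing above `M` vanishes above `M + a`. [this work] -/
theorem slice_eq_zero (μ : ℕ → ℝ) (a : ℕ) (g : ℝ) (M : ℕ) (hμM : ∀ h, M < h → μ h = 0) (h : ℕ) (hh : M + a < h) :
    slice μ a g h = 0 := by
  simp only [slice]
  rw [hμM h (by omega), mul_zero, zero_add]
  split_ifs
  · rw [hμM (h - a) (by omega), mul_zero]
  · rw [mul_zero]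

/-- a slice of a law of mass `1` on `{0..M}` has mass `1` on `{0..M+a}`. [this work] -/
theorem sum_slice (μ : ℕ → ℝ) (a : ℕ) (g : ℝ) (M : ℕ) (hμM : ∀ h, M < h → μ h = 0)
    (hμ1 : ∑ h ∈ Finset.range (M + 1), μ h = 1) :
    ∑ h ∈ Finset.range (M + a + 1), slice μ a g h = 1 := by
  simp only [slice]
  rw [Finset.sum_add_distrib, ← Finset.mul_sum, ← Finset.mul_sum, sum_shift μ M a, sum_range_extend μ M a hμM, hμ1]
  ring

/-- the shifted row of a slice carries mass `g` on the atoms `≥ a`: `Σ_{h ∈ [a, M+a]} g·μ(h−a)·[a ≤ h] = g`. [this work] -/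
theorem sum_Ico_shift_row (μ : ℕ → ℝ) (a : ℕ) (g : ℝ) (M : ℕ) (hμ1 : ∑ h ∈ Finset.range (M + 1), μ h = 1) :
    ∑ h ∈ Finset.Ico a (M + a + 1), g * (if a ≤ h then μ (h - a) else 0) = g := by
  rw [← Finset.mul_sum, Finset.sum_Ico_eq_sum_range, show M + a + 1 - a = M + 1 by omega]
  have e : ∑ k ∈ Finset.range (M + 1), (if a ≤ a + k then μ (a + k - a) else 0) = ∑ k ∈ Finset.range (M + 1), μ k := by
    refine Finset.sum_congr rfl fun k _ => ?_
    rw [if_pos (Nat.le_add_right a k), Nat.add_sub_cancel_left]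
  rw [e, hμ1, mul_one]

/-- the mean of a slice: `Σ h·slice μ a g h = T + a·g` (`T` the mean of `μ`, mass `1`). [this work] -/
theorem sum_mul_slice (μ : ℕ → ℝ) (a : ℕ) (g : ℝ) (M : ℕ) (hμM : ∀ h, M < h → μ h = 0)
    (hμ1 : ∑ h ∈ Finset.range (M + 1), μ h = 1) :
    ∑ h ∈ Finset.range (M + a + 1), (h : ℝ) * slice μ a g h
      = ∑ h ∈ Finset.range (M + 1), (h : ℝ) * μ h + (a : ℝ) * g := by
  simp only [slice]
  have e : ∀ h : ℕ, (h : ℝ) * ((1 - g) * μ h + g * (if a ≤ h then μ (h - a) else 0))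
      = (1 - g) * ((h : ℝ) * μ h) + g * ((h : ℝ) * (if a ≤ h then μ (h - a) else 0)) := fun h => by ring
  simp_rw [e]
  rw [Finset.sum_add_distrib, ← Finset.mul_sum, ← Finset.mul_sum, sum_mul_shift μ M a, hμ1,
    sum_range_extend (fun h => (h : ℝ) * μ h) M a (fun h hh => by simp only [hμM h hh, mul_zero])]
  ring

/-! ### The small-layer case of SL: `j′ < a` -/

/-- **SL BELOW THE BLOB SIZE, UNCONDITIONALLY.**  For a law `μ ≥ 0` on `{0..M}` of mass `1`, a blob size `a`, a gate `g < 1` with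
`0 < x ≤ g`, and a layer `j′ < a`, the slice `LawDec.slice μ a g` is DEC(j′) at floor `x` (`Quant.LawDec.DECAt x j′ (M + a) _`):
all atoms `≥ a > j′` of the shifted row are giants, so `P_G ≥ g ≥ x` and `x·P(low) ≤ x·(1 − P_G) ≤ (1−x)·P_G` — criterion E
(`LawDec.decAt_of_giantsAbsorbLows`).  No DEC hypothesis on `μ` and no top-affordability is used. [this work] -/
theorem slice_decAt_of_lt (x g : ℝ) (M a j' : ℕ) (μ : ℕ → ℝ)
    (hx0 : 0 < x) (hxg : x ≤ g) (hg1 : g < 1)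
    (hμ0 : ∀ h, 0 ≤ μ h) (hμM : ∀ h, M < h → μ h = 0) (hμ1 : ∑ h ∈ Finset.range (M + 1), μ h = 1)
    (hja : j' < a) :
    DECAt x j' (M + a) (slice μ a g) := by
  have hg0 : 0 ≤ g := hx0.le.trans hxg
  have hν0 : ∀ h, 0 ≤ slice μ a g h := slice_nonneg μ a g hg0 hg1.le hμ0
  have hνM : ∀ h, M + a < h → slice μ a g h = 0 := slice_eq_zero μ a g M hμM
  have hν1 := sum_slice μ a g M hμM hμ1
  -- giant mass ≥ g
  set PG : ℝ := ∑ h ∈ Finset.Ico (j' + 1) (M + a + 1), slice μ a g h with hPG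
  have hPG_ge : g ≤ PG := by
    have h1 : ∑ h ∈ Finset.Ico a (M + a + 1), slice μ a g h ≤ PG := by
      rw [hPG]
      exact Finset.sum_le_sum_of_subset_of_nonneg (Finset.Ico_subset_Ico (by omega) le_rfl) fun h _ _ => hν0 h
    have h2 : ∑ h ∈ Finset.Ico a (M + a + 1), g * (if a ≤ h then μ (h - a) else 0)
        ≤ ∑ h ∈ Finset.Ico a (M + a + 1), slice μ a g h := by
      refine Finset.sum_le_sum fun h _ => ?_
      simp only [slice]
      linarith [mul_nonneg (by linarith : (0 : ℝ) ≤ 1 - g) (hμ0 h)]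
    rw [sum_Ico_shift_row μ a g M hμ1] at h2
    linarith
  -- low mass ≤ mass of the atoms ≤ j′ = 1 − PG
  have hsplit : ∑ h ∈ Finset.range (j' + 1), slice μ a g h + PG = 1 := by
    rw [hPG, Finset.range_eq_Ico, Finset.sum_Ico_consecutive _ (Nat.zero_le _) (by omega), ← Finset.range_eq_Ico, hν1]
  have hlow : ∑ h ∈ Finset.range (j' + 1),
      (if 2 * (h : ℝ) < ∑ k ∈ Finset.range (M + a + 1), (k : ℝ) * slice μ a g k then slice μ a g h else 0)
        ≤ 1 - PG := by
    have : ∑ h ∈ Finset.range (j' + 1),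
        (if 2 * (h : ℝ) < ∑ k ∈ Finset.range (M + a + 1), (k : ℝ) * slice μ a g k then slice μ a g h else 0)
          ≤ ∑ h ∈ Finset.range (j' + 1), slice μ a g h := by
      refine Finset.sum_le_sum fun h _ => ?_
      split_ifs
      · exact le_rfl
      · exact hν0 h
    linarith
  refine decAt_of_giantsAbsorbLows x j' (M + a) (slice μ a g) (by omega) hν0 hνM hν1 hx0 ?_
  rw [← hPG]
  have h1 : x * ∑ h ∈ Finset.range (j' + 1),
      (if 2 * (h : ℝ) < ∑ k ∈ Finset.range (M + a + 1), (k : ℝ) * slice μ a g k then slice μ a g h else 0)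
        ≤ x * (1 - PG) := mul_le_mul_of_nonneg_left hlow hx0.le
  nlinarith [hPG_ge, hxg, hg1]

/-- **SL ≡ SL on the layers `a ≤ j′`**: the `@[conjecture]` `LawDec.SliceClosed` is equivalent to its restriction to layers
`a ≤ j′ < M + a` (where both DEC hypotheses are live); below `a` it is `slice_decAt_of_lt`. [this work] -/
theorem sliceClosed_iff_le :
    SliceClosed ↔
      ∀ (x g : ℝ) (M a j' : ℕ) (μ : ℕ → ℝ),
        0 < x → x ≤ g → g < 1 → 1 ≤ a →
        (∀ h, 0 ≤ μ h) → (∀ h, M < h → μ h = 0) → (∑ h ∈ Finset.range (M + 1), μ h = 1) →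
        (∀ h, 0 < μ h → x * (h : ℝ) ≤ ∑ k ∈ Finset.range (M + 1), (k : ℝ) * μ k) →
        a ≤ j' → j' < M + a →
        DECAt x j' M μ → DECAt x (j' - a) M μ →
        DECAt x j' (M + a) (slice μ a g) := by
  constructor
  · intro hSL x g M a j' μ hx0 hxg hg1 ha hμ0 hμM hμ1 htop haj hjM hd hd'
    exact hSL x g M a j' μ hx0 hxg hg1 ha hμ0 hμM hμ1 htop hjM hd (fun _ => hd')
  · intro h x g M a j' μ hx0 hxg hg1 ha hμ0 hμM hμ1 htop hjM hd hd'
    by_cases haj : a ≤ j'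
    · exact h x g M a j' μ hx0 hxg hg1 ha hμ0 hμM hμ1 htop haj hjM hd (hd' haj)
    · exact slice_decAt_of_lt x g M a j' μ hx0 hxg hg1 hμ0 hμM hμ1 (not_le.1 haj)

end LawDec

end Quant

end Summit.CriticalPhenomena.PercolationContinuityZ3.Theorems
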